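import Summits.ABC.IUTFork.Cor312GenuineKDeepDatumLam
import Literature.IUT.LogVolume.GenuineTowerLocalType
import HarnessLib

/-!
# [IUTchIII] Cor. 3.12, branch C / R-W window table — THE LOCAL-TYPE LEMMA at the `K`-level pilot datum:
# every fibre point `x₀ | p` of a genuine Θ-volume datum over a rational pole of `j` away from `2·3·5·l` has
# `p ∤ e(K_{x₀}/ℚ_p)` and `e(K_{x₀}/ℚ_p) ∣ 60·l` (at `λ_k = 1/2 + 2/7^k`, `p = 7`: verbatim finding F1-4 of abc-iut rw-num-lead)

PROOF-ONLY support file (D-0012; 0 definitions, 0 `Prop` facts) of the abc-iut cell (R-W «WINDOW Θ-SIDE INEQUALITY», seat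
abc-iut-W-neg-1 gen 0; director-abc W13 (B) «LOCAL-TYPE LEMMA»). TAKES NO SIDE on [IUTchIII] Cor. 3.12 (S. Mochizuki,
*Inter-universal Teichmüller theory III*, RIMS manuscript, Cor. 3.12 p. 173–174) or on any author: classical algebraic
number theory on the cell's typed Θ-volume data.

CONTEXT. The per-datum refutation engine of the hull-level clause S_H at the sharp genuine setting
(abc-iut-C-cert-1 `Conditional.GenuineK.not_pilotKummerCompatHull_chosen_of_explicit_depth`, p438886; abc-iut-w5-d107's
explicit depth inequality) reads the [IUTchIV] Prop. 1.1/1.2 constants `d, a, b` of the completion `K_{x₀}` at ONE bad place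
`x₀ | p`; all three are functions of the absolute ramification index `e = e(K_{x₀}/ℚ_p)` once `p ∤ e` (`d = (e−1)/e`,
`a = ⌈e/(p−2)⌉/e`, `b = ⌊log(pe/(p−1))/log p⌋ − 1/e`). abc-iut-c312-7's `GenuineK.exists_bad_tame_place_of_ord_neg` /
`exists_place_lamSeven` supply `p ∤ e` and the crude bound `e ≤ 46080·l(l−1)²(l+1)`; the R-W window table (rw-num-lead,
WINDOW-TABLE v1 finding F1-4) showed that the decisive input is the LOCAL TYPE `e ∣ 60·l` (then `b ≤ ⌊log₇(70·l)⌋ − 1/e`),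
which THIS FILE proves for EVERY fibre point over the pole:

* `Conditional.GenuineK.absRamificationIdx_kOf_dvd_ratPoint` — for a genuine Θ-volume datum `T` at a RATIONAL point
  `(ratPoint q, l)`, a prime `p ∉ {2, 3, 5, l}` at which `j(q)` has a pole, and EVERY fibre point `x₀ | p` of the index of
  `pilotDataOfK T.D T.K`: `e(K_{x₀}/ℚ_p) ∣ 60·l` and `¬ p ∣ e(K_{x₀}/ℚ_p)` (the place form is this seat's
  `Cor22.ThetaVolumeDatumAt.ramificationIdx_int_dvd_sixty_mul_ratPoint'`, `GenuineTowerLocalType.lean`: `e(u|w) ∣ l` for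
  `K/F` at multiplicative places (abc-iut-S-d1 `ramificationIdx_dvd_prime`), `e(w|v₀) ∣ 60` for `F/F_tpd` at bad places
  `∤ 30` (this seat's `ramificationIdx_subThetaField_dvd_sixty`: inertia fixes `√−1` and the even twist root and acts
  unipotently on `E_λ[3]`, `E_λ[5]` up to the twist character — abc-iut-L5-t12's p455303), `e(v₀|p) = 1` over `ℚ`);
* **`Conditional.GenuineK.localType_lamSeven`** — at `λ_k = 1/2 + 2/7^k` (`k ≥ 1`), `l ≥ 11` (prime, from the datum), `p = 7`
  (`ord_7 j(λ_k) = −2k < 0`, abc-iut-w5-d044's `Cor22.ord_jInv_lamSeven_neg`): for EVERY genuine Θ-volume datum `T` at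
  `(ratPoint λ_k, l)` and EVERY `x₀ | 7`: **`¬ 7 ∣ e(K_{x₀}/ℚ_7) ∧ e(K_{x₀}/ℚ_7) ∣ 60·l`** — finding F1-4 verbatim;
* `Conditional.GenuineK.absRamificationIdx_kOf_le_lamSeven` — hence `e(K_{x₀}/ℚ_7) ≤ 60·l`.

HONEST FRAMING: bookkeeping over OUR typed objects (the cell's sharp honestly-scaled genuine setting); nothing here bears on
the printed inequality of [IUTchIII] Cor. 3.12 or on the number-level `Cor22.Cor312AtDatum`; typed ≠ proved; instantiated
≠ endorsed. [cite: Mochizuki2012, IUTchI Def. 3.1 (b),(c) p. 61–62, Ex. 3.2 (iv) p. 71; IUTchIV Thm. 1.10 Steps (ii)–(iii) p. 24–26, Cor. 2.2 (ii) proof (P5) p. 46]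
[cite: Serre1972, §1.11–§1.12] [claim: Mochizuki2012, status: disputed] for every IUT quotation.
-/

noncomputable section

open NumberField IsDedekindDomain

namespace Summit.ABC.IUTFork.Conditional

open Thm311 Thm311.Real Cor312 Cor312Prov Literature.IUT.LogVolume Literature.IUT.HodgeTheaters
  Literature.IUT.LogThetaLattice Literature.NumberTheory.NumberFields Literature.NumberTheory.DiophantineGeometry.GenEll
  Literature.NumberTheory.DiophantineGeometry

/-- **The local type at a fibre point over a rational pole of `j`, away from `2·3·5·l`.** For a genuine Θ-volume datum
`T` at `(ratPoint q, l)`, a prime `p ∉ {2, 3, 5, l}` such that `ord_v j(q) < 0` at the place `v` of `ℚ` over `p`, and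
EVERY point `x₀` of the fibre over `p` of the index of the `K`-level pilot datum `pilotDataOfK T.D T.K`:
`e(K_{x₀}/ℚ_p) ∣ 60·l` and `p ∤ e(K_{x₀}/ℚ_p)` (the completion `K_{x₀}` is abc-iut-S7's rescaled completion at the place
`placeOf x₀`, whose norm-defined absolute ramification index IS `e(placeOf x₀ | p)`, `absRamificationIdx_rescaledCompletion`).
[cite: Mochizuki2012, IUTchIV Thm. 1.10 proof Steps (ii)–(iii) p. 24–26] [cite: Serre1972, §1.11–§1.12]
[claim: Mochizuki2012, status: disputed] -/
theorem GenuineK.absRamificationIdx_kOf_dvd_ratPoint {q : ℚ} {l : ℕ} (T : Cor22.ThetaVolumeDatumAt (ratPoint q) l)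
    (pp : Nat.Primes) (hp2 : (pp : ℕ) ≠ 2) (hp3 : (pp : ℕ) ≠ 3) (hp5 : (pp : ℕ) ≠ 5) (hpl : (pp : ℕ) ≠ l)
    (hpole : ∀ v : HeightOneSpectrum (𝓞 ℚ), Rat.HeightOneSpectrum.natGenerator v = pp →
      Literature.IUT.LogVolume.ord ℚ v (Cor22.jInv q) < 0) :
    letI := T.instFieldF; letI := T.instNumberFieldF; letI := T.instAlgebraF; letI := T.instFieldK
    letI := T.instNumberFieldK; letI := T.instAlgebraK; letI := T.instFieldFbar; letI := T.instAlgebraFbar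
    letI := T.instAlgebraKFbar; letI := T.instIsElliptic
    haveI : Fact (pp : ℕ).Prime := ⟨pp.2⟩
    ∀ x₀ : (thetaIndex (pilotDataOfK T.D T.K)).Fibre (.inr pp),
      absRamificationIdx (pp : ℕ) (kOf (pilotDataOfK T.D T.K) pp.1 x₀) ∣ 60 * l ∧
      ¬ (pp : ℕ) ∣ absRamificationIdx (pp : ℕ) (kOf (pilotDataOfK T.D T.K) pp.1 x₀) := by
  letI := T.instFieldF; letI := T.instNumberFieldF; letI := T.instAlgebraF; letI := T.instFieldK
  letI := T.instNumberFieldK; letI := T.instAlgebraK; letI := T.instFieldFbar; letI := T.instAlgebraFbar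
  letI := T.instAlgebraKFbar; letI := T.instIsElliptic
  haveI : Fact (pp : ℕ).Prime := ⟨pp.2⟩
  set X := pilotDataOfK T.D T.K with hXdef
  intro x₀
  set w := placeOf X pp.1 x₀ with hwdef
  have hpw : ((pp : ℕ) : 𝓞 T.K) ∈ w.asIdeal := natCast_mem_placeOf X pp.1 x₀
  have hwchar : residueChar T.K w = (pp : ℕ) := residueChar_eq_of_natCast_mem pp.1 hpw
  -- the norm-defined `e(K_{x₀}/ℚ_p)` is `e(w | p)`
  have hekOf : absRamificationIdx (pp : ℕ) (kOf X pp.1 x₀) = w.asIdeal.ramificationIdx ℤ := by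
    rw [show absRamificationIdx (pp : ℕ) (kOf X pp.1 x₀) =
        absRamificationIdx (pp : ℕ) (RescaledCompletion T.K pp.1 (placeOf X pp.1 x₀) hpw) from rfl,
      absRamificationIdx_rescaledCompletion]
  have hnot : (pp : ℕ) ∉ ({2, 3, 5, l} : Finset ℕ) := by
    simp only [Finset.mem_insert, Finset.mem_singleton, not_or]
    exact ⟨hp2, hp3, hp5, hpl⟩
  have hdvd : w.asIdeal.ramificationIdx ℤ ∣ 60 * l :=
    T.ramificationIdx_int_dvd_sixty_mul_ratPoint' hnot hpole w hwchar
  rw [hekOf]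
  refine ⟨hdvd, fun h => ?_⟩
  -- `p ∤ 60·l` for a prime `p ∉ {2, 3, 5, l}`
  have h' : (pp : ℕ) ∣ 60 * l := h.trans hdvd
  have hl : l.Prime := T.D.l_prime
  rcases (Nat.Prime.dvd_mul pp.2).1 h' with h60 | hll
  · have h60' : (pp : ℕ) ∣ 2 ^ 2 * 3 * 5 := by norm_num; exact h60
    rcases (Nat.Prime.dvd_mul pp.2).1 h60' with h23 | h5'
    · rcases (Nat.Prime.dvd_mul pp.2).1 h23 with h2' | h3'
      · exact hp2 ((Nat.prime_dvd_prime_iff_eq pp.2 Nat.prime_two).1 (pp.2.dvd_of_dvd_pow h2'))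
      · exact hp3 ((Nat.prime_dvd_prime_iff_eq pp.2 Nat.prime_three).1 h3')
    · exact hp5 ((Nat.prime_dvd_prime_iff_eq pp.2 Nat.prime_five).1 h5')
  · exact hpl ((Nat.prime_dvd_prime_iff_eq pp.2 hl).1 hll)

/-- **THE LOCAL-TYPE LEMMA of the R-W window table (rw-num-lead WINDOW-TABLE v1, finding F1-4), verbatim.** For `k ≥ 1`,
`l ≥ 11` (`l` is prime by [IUTchI] Def. 3.1 (c), `T.D.l_prime`) and EVERY genuine Θ-volume datum `T` at `(ratPoint λ_k, l)`, `λ_k = 1/2 + 2/7^k` (pole of `j` of order `2k`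
at `7`, abc-iut-w5-d044's `Cor22.ord_jInv_lamSeven_neg`), and EVERY fibre point `x₀ | 7` of the index of
`pilotDataOfK T.D T.K`: **`¬ 7 ∣ e(K_{x₀}/ℚ_7)` and `e(K_{x₀}/ℚ_7) ∣ 60·l`** — the completion is TAME over `ℚ_7` of
ramification index a divisor of `60·l` (Kummer/Tate structure of the `30l`-torsion at the multiplicative prime `7`:
`e(x₀|v) ∣ l`, `e(v|7) ∣ 60`). [cite: Mochizuki2012, IUTchI Ex. 3.2 (iv) p. 71; IUTchIV Cor. 2.2 (ii) proof (P5) p. 46]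
[cite: Serre1972, §1.11–§1.12] [claim: Mochizuki2012, status: disputed] -/
theorem GenuineK.localType_lamSeven {k l : ℕ} (hk : 1 ≤ k) (h11 : 11 ≤ l)
    (T : Cor22.ThetaVolumeDatumAt (ratPoint ((2 : ℚ)⁻¹ + 2 / 7 ^ k)) l) :
    letI := T.instFieldF; letI := T.instNumberFieldF; letI := T.instAlgebraF; letI := T.instFieldK
    letI := T.instNumberFieldK; letI := T.instAlgebraK; letI := T.instFieldFbar; letI := T.instAlgebraFbar
    letI := T.instAlgebraKFbar; letI := T.instIsElliptic
    haveI : Fact (Nat.Prime 7) := ⟨by norm_num⟩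
    ∀ x₀ : (thetaIndex (pilotDataOfK T.D T.K)).Fibre (.inr ⟨7, by norm_num⟩),
      ¬ 7 ∣ absRamificationIdx 7 (kOf (pilotDataOfK T.D T.K) 7 x₀) ∧
      absRamificationIdx 7 (kOf (pilotDataOfK T.D T.K) 7 x₀) ∣ 60 * l := by
  intro x₀
  have h := GenuineK.absRamificationIdx_kOf_dvd_ratPoint T ⟨7, by norm_num⟩ (by norm_num) (by norm_num) (by norm_num)
    (show (7 : ℕ) ≠ l by omega) (fun v hv => Cor22.ord_jInv_lamSeven_neg v hv hk) x₀
  exact ⟨h.2, h.1⟩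

/-- **Corollary: `e(K_{x₀}/ℚ_7) ≤ 60·l`** at every fibre point `x₀ | 7` of a genuine Θ-volume datum at `(ratPoint λ_k, l)`
(`k ≥ 1`, `l ≥ 11`) — against the crude `46080·l(l−1)²(l+1)` of `GenuineK.exists_place_lamSeven`; with `p ∤ e` this
caps the [IUTchIV] Prop. 1.2 constant `b = ⌊log₇(7e/6)⌋ − 1/e` by `⌊log₇(70·l)⌋ − 1/e`.
[cite: Mochizuki2012, IUTchIV Prop. 1.2 p. 10] [claim: Mochizuki2012, status: disputed] -/
theorem GenuineK.absRamificationIdx_kOf_le_lamSeven {k l : ℕ} (hk : 1 ≤ k) (h11 : 11 ≤ l)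
    (T : Cor22.ThetaVolumeDatumAt (ratPoint ((2 : ℚ)⁻¹ + 2 / 7 ^ k)) l) :
    letI := T.instFieldF; letI := T.instNumberFieldF; letI := T.instAlgebraF; letI := T.instFieldK
    letI := T.instNumberFieldK; letI := T.instAlgebraK; letI := T.instFieldFbar; letI := T.instAlgebraFbar
    letI := T.instAlgebraKFbar; letI := T.instIsElliptic
    haveI : Fact (Nat.Prime 7) := ⟨by norm_num⟩
    ∀ x₀ : (thetaIndex (pilotDataOfK T.D T.K)).Fibre (.inr ⟨7, by norm_num⟩),
      absRamificationIdx 7 (kOf (pilotDataOfK T.D T.K) 7 x₀) ≤ 60 * l := by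
  intro x₀
  exact Nat.le_of_dvd (by omega) (GenuineK.localType_lamSeven hk h11 T x₀).2

end Summit.ABC.IUTFork.Conditional

end
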